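import Literature.NumberTheory.EllipticCurves.ModularFunctionFieldIntegralClosure
import Literature.NumberTheory.EllipticCurves.ModularCurveCoordinateFunctions
import Mathlib.RingTheory.Finiteness.Nakayama
import HarnessLib

/-!
# The local ring of `X₀(N)` at a point of `ℍ` is generated by Eisenstein coordinates

Topic `NumberTheory/EllipticCurves` (fourth file of the "canonical model of `X₀(N)` at CM points"
chain).  Let `v = (v₀, …, v₇)` be the eight weight-zero modular functions
`m/Δ ∈ K_N = ℂ(X₀(N))` with `m ∈ {E₄³, E₆², E₄²E₄(Nτ), E₆E₆(Nτ), E₄(Nτ)³, E₆(Nτ)², E₄E₄(Nτ)², E₄³}`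
(`coordFn`; the first six are the Eisenstein coordinates of `ModularCurveEisensteinCoordinates`,
`v₇ = j`), all holomorphic on `ℍ` with `q`-expansions in `ℚ((q))`, and let `A₀ = ℂ[v] ⊆ K_N` be the
algebra they generate (the image of `P = ℂ[X₀, …, X₇]` under `aeval v`, `algebraCoord`).  The main
theorem of the file is

* `exists_mul_aeval_eq_aeval` — **for every `τ₀ ∈ ℍ` and every `h ∈ K_N` regular at `τ₀` there are
  polynomials `p, q ∈ P` with `q(v(τ₀)) ≠ 0` and `h · q(v) = p(v)`**: the local ring `O_{P_{τ₀}}` of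
  `X₀(N)` at `τ₀` is the localisation of `A₀` at the point `v(τ₀)`.

Proof (Zariski-local structure of the finite map `Y₀(N) → Spec A₀`): with `B ⊇ A₀` the integral
closure of `ℂ[j]` (`intClosureJ`, finite over `ℂ[j]`, Dedekind, the ring of functions holomorphic on
`ℍ` — `ModularFunctionFieldIntegralClosure`), `𝔭 = ker (ev_{τ₀} : P → ℂ)` and `𝔮 = B ∩ m_{τ₀}`:
(1) every prime of `B` over `𝔭B` is a `B ∩ m_{τ'}` with `v(τ') = v(τ₀)` (`exists_eq_idealAt`), hence
equals `𝔮` because **the Eisenstein coordinates separate the points of `Y₀(N)`**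
(`exists_gamma0_smul_eq_of_eisCoord_eq`); (2) so `𝔭B = 𝔮ᵉ` (Dedekind), and `e = 1` because **`A₀`
contains a uniformizer at every point** (`exists_aeval_pointValuation_eq`: `j − j(τ₀)`, `E₆E₆(Nτ)/Δ`
or `E₄E₄(Nτ)²/Δ` according to the elliptic type of `τ₀`, using `E₆(Nτ₀) ≠ 0`, `E₄(Nτ₀) ≠ 0` at
non-elliptic points of the orbits of `i`, `ρ` — `ModularFunctionFieldUniformizers`); (3) hence
`B = A₀ + 𝔭B` and Nakayama's lemma over `P` gives `s ∈ A₀` with `s(τ₀) = 1` and `sB ⊆ A₀`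
(`exists_aeval_mul_intClosureJ_subset`); (4) finally the poles of `h` away from `τ₀` are killed by a
polynomial in `j` and in the `vᵢ − vᵢ(τ')` over the other points `τ'` of the fibre of `j`
(`placesOver`, `sum_ord_placesOver`).  (Shimura 1971, §1.6–1.8, §2.4; Diamond–Shurman 2005, §7.5;
the commutative algebra is Atiyah–Macdonald Prop. 2.6, Cor. 5.22, Thm. 9.3.)

Everything is proved; no named facts are introduced.  The sequel evaluates `h = x(φ(τ))`, the
`x`-coordinate of a modular parametrisation, at CM points through this representation.

## References

* G. Shimura, *Introduction to the arithmetic theory of automorphic functions*, 1971, §1.6–1.8, §2.4.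
  [ShimuraIATAF1971]
* F. Diamond, J. Shurman, *A First Course in Modular Forms*, GTM 228, 2005, §2.3, §3.1, §7.5.
  [DiamondShurman2005]
-/

noncomputable section

open scoped MatrixGroups ModularForm Modular Classical IntermediateField WithZero
open CongruenceSubgroup Matrix.SpecialLinearGroup ModularGroup ModularForm EisensteinSeries Polynomial
open UpperHalfPlane hiding I
open Literature.NumberTheory.DiophantineGeometry
open Literature.NumberTheory.DiophantineGeometry.AlgFunctionField

namespace Literature.NumberTheory.EllipticCurves.ModularForms

variable {N : ℕ} [NeZero N]

attribute [local instance] algebraPolyJ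

/-! ### The eight coordinate functions (`ModularCurveCoordinateFunctions`) lie in `B` -/

/-- The coordinate functions lie in `B`. [folklore] -/
theorem coordFn_mem_intClosureJ (i : Fin 8) : coordFn N i ∈ intClosureJ N :=
  mkFn_deltaN_mem_intClosureJ _

/-! ### The coordinate algebra `A₀ = ℂ[v₀, …, v₇]` as the image of `P = ℂ[X₀, …, X₇]` -/

/-- The polynomial ring `P = ℂ[X₀, …, X₇]`. [folklore] -/
abbrev CoordPoly : Type := MvPolynomial (Fin 8) ℂ

variable (N) in
/-- `P` acts on `K_N` through `Xᵢ ↦ vᵢ` (a local instance). [folklore] -/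
@[reducible] def algebraCoord : Algebra CoordPoly (modularFunctionField N) :=
  (MvPolynomial.aeval (coordFn N)).toRingHom.toAlgebra

attribute [local instance] algebraCoord

/-- The structure map `P → K_N` is `aeval v`. [folklore] -/
theorem algebraMap_coord (p : CoordPoly) :
    algebraMap CoordPoly (modularFunctionField N) p = MvPolynomial.aeval (coordFn N) p := rfl

/-- `p • x = p(v)·x`. [folklore] -/
theorem coord_smul_def (p : CoordPoly) (x : modularFunctionField N) :
    p • x = MvPolynomial.aeval (coordFn N) p * x := Algebra.smul_def p x

/-- `ℂ → P → K_N` is a scalar tower. [folklore] -/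
instance isScalarTower_coord : IsScalarTower ℂ CoordPoly (modularFunctionField N) :=
  IsScalarTower.of_algebraMap_eq fun c ↦ by
    rw [algebraMap_coord, MvPolynomial.algebraMap_eq, MvPolynomial.aeval_C]

/-- `ℂ[X] → P`, `X ↦ X₇` (so that `j`-polynomials are coordinate polynomials). [folklore] -/
def polyToCoord : ℂ[X] →ₐ[ℂ] CoordPoly := Polynomial.aeval (MvPolynomial.X 7)

/-- Compatibility `a(j) = (polyToCoord a)(v)`. [folklore] -/
theorem aeval_polyToCoord (a : ℂ[X]) :
    MvPolynomial.aeval (coordFn N) (polyToCoord a) = Polynomial.aeval (kleinJK N) a := by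
  rw [polyToCoord, ← Polynomial.aeval_algHom_apply, MvPolynomial.aeval_X, coordFn_seven]

/-- `p(v)` is holomorphic on `ℍ`. [folklore] -/
theorem aeval_mem_intClosureJ (p : CoordPoly) : MvPolynomial.aeval (coordFn N) p ∈ intClosureJ N := by
  let B' : Subalgebra ℂ (modularFunctionField N) :=
    { (intClosureJ N).toSubring with
      algebraMap_mem' := fun c ↦ by
        change algebraMap ℂ (modularFunctionField N) c ∈ intClosureJ N
        rw [IsScalarTower.algebraMap_apply ℂ ℂ[X] (modularFunctionField N)]
        exact (intClosureJ N).algebraMap_mem _ }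
  have hle : Algebra.adjoin ℂ (Set.range (coordFn N)) ≤ B' :=
    Algebra.adjoin_le (Set.range_subset_iff.mpr fun i ↦ coordFn_mem_intClosureJ i)
  have hmem : MvPolynomial.aeval (coordFn N) p ∈ Algebra.adjoin ℂ (Set.range (coordFn N)) := by
    rw [Algebra.adjoin_range_eq_range_aeval]; exact ⟨p, rfl⟩
  exact hle hmem

/-- `p(v) ∈ O_{P_τ}`. [folklore] -/
theorem aeval_mem_pointPlace (p : CoordPoly) (τ : ℍ) :
    MvPolynomial.aeval (coordFn N) p ∈ (pointPlace (N := N) τ).toValuationSubring :=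
  mem_pointPlace_of_mem_intClosureJ (aeval_mem_intClosureJ p) τ

/-- `v_τ(p(v)) ≤ 1`. [folklore] -/
theorem pointValuation_aeval_le_one (p : CoordPoly) (τ : ℍ) :
    pointValuation (N := N) τ (MvPolynomial.aeval (coordFn N) p) ≤ 1 :=
  (mem_pointPlace_iff τ _).mp (aeval_mem_pointPlace p τ)

/-- **`p(v(τ))` is the value of `p(v)` at `P_τ`**: `v_τ(p(v) − p(v(τ))) < 1`. [folklore] -/
theorem pointValuation_aeval_sub_eval_lt_one (p : CoordPoly) (τ : ℍ) :
    pointValuation (N := N) τ (MvPolynomial.aeval (coordFn N) p -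
      algebraMap ℂ (modularFunctionField N) (MvPolynomial.eval (fun i ↦ coordVal N i τ) p)) < 1 := by
  set v := pointValuation (N := N) τ with hv
  induction p using MvPolynomial.induction_on with
  | C a => rw [MvPolynomial.aeval_C, MvPolynomial.eval_C, sub_self, Valuation.map_zero]; exact one_pos
  | add p q hp hq =>
    rw [map_add, map_add, map_add, add_sub_add_comm]
    exact (Valuation.map_add _ _ _).trans_lt (max_lt hp hq)
  | mul_X p i hp =>
    rw [map_mul, map_mul, map_mul, MvPolynomial.aeval_X, MvPolynomial.eval_X]
    set x := MvPolynomial.aeval (coordFn N) p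
    set a := algebraMap ℂ (modularFunctionField N) (MvPolynomial.eval (fun i ↦ coordVal N i τ) p)
    set y := coordFn N i
    set b := algebraMap ℂ (modularFunctionField N) (coordVal N i τ)
    have hxy : x * y - a * b = x * (y - b) + (x - a) * b := by ring
    rw [hxy]
    refine (Valuation.map_add _ _ _).trans_lt (max_lt ?_ ?_)
    · rw [Valuation.map_mul]
      calc v x * v (y - b) ≤ 1 * v (y - b) :=
            mul_le_mul' (pointValuation_aeval_le_one p τ) le_rfl
        _ < 1 := by rw [one_mul]; exact pointValuation_coordFn_sub_lt_one i τ
    · rw [Valuation.map_mul]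
      calc v (x - a) * v b ≤ v (x - a) * 1 :=
            mul_le_mul' le_rfl (pointValuation_algebraMap_le_one _ τ)
        _ < 1 := by rw [mul_one]; exact hp

/-- **`v_τ(p(v)) < 1 ↔ p(v(τ)) = 0`.** [folklore] -/
theorem pointValuation_aeval_lt_one_iff (p : CoordPoly) (τ : ℍ) :
    pointValuation (N := N) τ (MvPolynomial.aeval (coordFn N) p) < 1 ↔
      MvPolynomial.eval (fun i ↦ coordVal N i τ) p = 0 := by
  have h := pointValuation_aeval_sub_eval_lt_one (N := N) p τ
  set c := MvPolynomial.eval (fun i ↦ coordVal N i τ) p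
  constructor
  · intro hlt
    by_contra hc
    have h1 := pointValuation_algebraMap_eq_one (N := N) hc τ
    have : pointValuation (N := N) τ (algebraMap ℂ (modularFunctionField N) c) < 1 := by
      have heq : algebraMap ℂ (modularFunctionField N) c =
          MvPolynomial.aeval (coordFn N) p - (MvPolynomial.aeval (coordFn N) p - algebraMap ℂ _ c) := by
        ring
      rw [heq]
      exact (Valuation.map_sub _ _ _).trans_lt (max_lt hlt h)
    exact absurd h1 this.ne
  · intro hc
    rw [hc, map_zero, sub_zero] at h
    exact h

variable (N) in
/-- **The point ideal `𝔭_{τ₀} = ker (ev_{v(τ₀)} : P → ℂ)`** of coordinate polynomials vanishing at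
`v(τ₀)`. [folklore] -/
def evalKer (τ₀ : ℍ) : Ideal CoordPoly := RingHom.ker (MvPolynomial.eval fun i ↦ coordVal N i τ₀)

/-- Membership in `evalKer`. [folklore] -/
theorem mem_evalKer_iff (τ₀ : ℍ) (p : CoordPoly) :
    p ∈ evalKer N τ₀ ↔ MvPolynomial.eval (fun i ↦ coordVal N i τ₀) p = 0 := RingHom.mem_ker

/-- Membership in `evalKer` through the valuation: `p ∈ 𝔭_{τ₀} ↔ v_{τ₀}(p(v)) < 1`. [folklore] -/
theorem mem_evalKer_iff_lt_one (τ₀ : ℍ) (p : CoordPoly) :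
    p ∈ evalKer N τ₀ ↔ pointValuation (N := N) τ₀ (MvPolynomial.aeval (coordFn N) p) < 1 := by
  rw [mem_evalKer_iff, pointValuation_aeval_lt_one_iff]

/-- `v_{τ₀}(p(v)) = 1` for `p ∉ 𝔭_{τ₀}`. [folklore] -/
theorem pointValuation_aeval_eq_one_of_not_mem {τ₀ : ℍ} {p : CoordPoly} (hp : p ∉ evalKer N τ₀) :
    pointValuation (N := N) τ₀ (MvPolynomial.aeval (coordFn N) p) = 1 :=
  le_antisymm (pointValuation_aeval_le_one p τ₀) (not_lt.mp ((mem_evalKer_iff_lt_one τ₀ p).not.mp hp))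

/-! ### `B` as a `P`-module: finitely generated -/

variable (N) in
/-- `B` as a `P`-submodule of `K_N`. [folklore] -/
def intClosureMod : Submodule CoordPoly (modularFunctionField N) where
  carrier := intClosureJ N
  zero_mem' := zero_mem _
  add_mem' := add_mem
  smul_mem' p x hx := by
    change p • x ∈ intClosureJ N
    rw [coord_smul_def]; exact mul_mem (aeval_mem_intClosureJ p) hx

/-- Membership in `intClosureMod`. [folklore] -/
theorem mem_intClosureMod_iff (x : modularFunctionField N) :
    x ∈ intClosureMod N ↔ x ∈ intClosureJ N := Iff.rfl

/-- **`B` is a finitely generated `P`-module** (it is finite over `ℂ[j] = ℂ[X₇] ⊆ P`). [folklore] -/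
theorem intClosureMod_fg : (intClosureMod N).FG := by
  classical
  obtain ⟨S, hS⟩ := Module.Finite.fg_top (R := ℂ[X]) (M := intClosureJ N)
  refine ⟨S.image Subtype.val, le_antisymm ?_ ?_⟩
  · rw [Submodule.span_le]
    intro x hx
    rw [Finset.mem_coe, Finset.mem_image] at hx
    obtain ⟨b, -, rfl⟩ := hx
    exact b.2
  · intro x hx
    have hx' : (⟨x, hx⟩ : intClosureJ N) ∈ Submodule.span ℂ[X] (S : Set (intClosureJ N)) := by
      rw [hS]; trivial
    set T := Submodule.span CoordPoly (S.image Subtype.val : Set (modularFunctionField N)) with hT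
    suffices h : ∀ y : intClosureJ N, y ∈ Submodule.span ℂ[X] (S : Set (intClosureJ N)) →
        (y : modularFunctionField N) ∈ T from h _ hx'
    intro y hy
    induction hy using Submodule.span_induction with
    | mem z hz => exact Submodule.subset_span (Finset.mem_image_of_mem _ hz)
    | zero => exact zero_mem _
    | add z w _ _ hz hw => rw [Subalgebra.coe_add]; exact add_mem hz hw
    | smul a z _ hz =>
      rw [Subalgebra.coe_smul, Algebra.smul_def, algebraMap_polyJ, ← aeval_polyToCoord,
        ← coord_smul_def]
      exact T.smul_mem _ hz


/-! ### The ideal `𝔭B` generated by the point ideal equals `𝔮 = B ∩ m_{τ₀}` -/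

variable (N) in
/-- `aeval v : P → B`. [folklore] -/
def aevalB : CoordPoly →+* intClosureJ N :=
  (MvPolynomial.aeval (coordFn N)).toRingHom.codRestrict (intClosureJ N) aeval_mem_intClosureJ

/-- Unfolding of `aevalB`. [folklore] -/
@[simp] theorem coe_aevalB (p : CoordPoly) :
    (aevalB N p : modularFunctionField N) = MvPolynomial.aeval (coordFn N) p := rfl

variable (N) in
/-- **`𝔭B`**: the ideal of `B` generated by the coordinate polynomials vanishing at `v(τ₀)`. [folklore] -/
def pointIdealB (τ₀ : ℍ) : Ideal (intClosureJ N) := Ideal.map (aevalB N) (evalKer N τ₀)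

/-- `Xᵢ − vᵢ(τ₀) ∈ 𝔭_{τ₀}`. [folklore] -/
theorem X_sub_C_mem_evalKer (τ₀ : ℍ) (i : Fin 8) :
    MvPolynomial.X i - MvPolynomial.C (coordVal N i τ₀) ∈ evalKer N τ₀ := by
  rw [mem_evalKer_iff, map_sub, MvPolynomial.eval_X, MvPolynomial.eval_C, sub_self]

omit [NeZero N] in
/-- `(Xᵢ − c)(v) = vᵢ − c`. [folklore] -/
theorem aeval_X_sub_C (v : Fin 8 → modularFunctionField N) (i : Fin 8) (c : ℂ) :
    MvPolynomial.aeval v (MvPolynomial.X i - MvPolynomial.C c) = v i - algebraMap ℂ _ c := by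
  rw [map_sub, MvPolynomial.aeval_X, MvPolynomial.aeval_C]

/-- `𝔭B ≤ 𝔮`. [folklore] -/
theorem pointIdealB_le_idealAt (τ₀ : ℍ) : pointIdealB N τ₀ ≤ idealAt (N := N) τ₀ := by
  rw [pointIdealB, Ideal.map_le_iff_le_comap]
  intro p hp
  rw [Ideal.mem_comap, mem_idealAt_iff, coe_aevalB]
  exact (mem_evalKer_iff_lt_one τ₀ p).mp hp

/-- `𝔭B ≠ 0` (it contains `j − j(τ₀)`… rather `j − v₇(τ₀) ≠ 0`, `j` being transcendental). [folklore] -/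
theorem pointIdealB_ne_bot (τ₀ : ℍ) : pointIdealB N τ₀ ≠ ⊥ := by
  intro h
  have hmem : aevalB N (MvPolynomial.X 7 - MvPolynomial.C (coordVal N 7 τ₀)) ∈ pointIdealB N τ₀ :=
    Ideal.mem_map_of_mem _ (X_sub_C_mem_evalKer τ₀ 7)
  rw [h, Ideal.mem_bot, Subtype.ext_iff, coe_aevalB, aeval_X_sub_C, coordFn_seven,
    ZeroMemClass.coe_zero, sub_eq_zero] at hmem
  apply transcendental_kleinJK (N := N)
  rw [hmem]
  exact isAlgebraic_algebraMap _

/-- **The coordinates separate the points of `Y₀(N)`, ideal form: every prime of `B` over `𝔭B` is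
`𝔮`** (`exists_eq_idealAt` + `exists_gamma0_smul_eq_of_eisCoord_eq`). [folklore] -/
theorem eq_idealAt_of_isPrime_of_le {τ₀ : ℍ} {Q : Ideal (intClosureJ N)} [Q.IsPrime]
    (hQ : pointIdealB N τ₀ ≤ Q) : Q = idealAt (N := N) τ₀ := by
  have hQ0 : Q ≠ ⊥ := fun h ↦ pointIdealB_ne_bot τ₀ (le_bot_iff.mp (h ▸ hQ))
  obtain ⟨τ', rfl⟩ := exists_eq_idealAt Q hQ0
  apply idealAt_eq_of_pointPlace_eq
  have hval : ∀ i, coordVal N i τ' = coordVal N i τ₀ := by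
    intro i
    have h1 : pointValuation (N := N) τ'
        (coordFn N i - algebraMap ℂ (modularFunctionField N) (coordVal N i τ₀)) < 1 := by
      have := hQ (Ideal.mem_map_of_mem (aevalB N) (X_sub_C_mem_evalKer τ₀ i))
      rw [mem_idealAt_iff, coe_aevalB, aeval_X_sub_C] at this
      exact this
    have h2 := pointValuation_coordFn_sub_lt_one (N := N) i τ'
    by_contra hne
    have h3 : pointValuation (N := N) τ'
        (algebraMap ℂ (modularFunctionField N) (coordVal N i τ' - coordVal N i τ₀)) < 1 := by
      have heq : algebraMap ℂ (modularFunctionField N) (coordVal N i τ' - coordVal N i τ₀) =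
          (coordFn N i - algebraMap ℂ (modularFunctionField N) (coordVal N i τ₀)) -
            (coordFn N i - algebraMap ℂ (modularFunctionField N) (coordVal N i τ')) := by
        rw [map_sub]; ring
      rw [heq]
      exact (Valuation.map_sub _ _ _).trans_lt (max_lt h1 h2)
    exact absurd (pointValuation_algebraMap_eq_one (N := N) (sub_ne_zero.mpr hne) τ') h3.ne
  have heis : ∀ i : Fin 6, eisCoord N i τ' = eisCoord N i τ₀ := fun i ↦ by
    rw [← coordVal_castLE, ← coordVal_castLE]; exact hval _
  obtain ⟨γ, hγ⟩ := exists_gamma0_smul_eq_of_eisCoord_eq heis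
  rw [← hγ]
  exact (pointPlace_smul_of_mem γ.2 τ').symm

/-- `√(𝔭B) = 𝔮`. [folklore] -/
theorem radical_pointIdealB (τ₀ : ℍ) : (pointIdealB N τ₀).radical = idealAt (N := N) τ₀ := by
  rw [Ideal.radical_eq_sInf]
  apply le_antisymm
  · exact sInf_le ⟨pointIdealB_le_idealAt τ₀, inferInstance⟩
  · apply le_sInf
    rintro J ⟨hJ, hJp⟩
    exact (eq_idealAt_of_isPrime_of_le hJ).ge

/-- `𝔭B = 𝔮ᵉ` for some `e ≥ 1` (`B` is a Dedekind domain). [folklore] -/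
theorem exists_pointIdealB_eq_pow (τ₀ : ℍ) :
    ∃ e : ℕ, 0 < e ∧ pointIdealB N τ₀ = idealAt (N := N) τ₀ ^ e := by
  have hfg : (idealAt (N := N) τ₀).FG := IsNoetherian.noetherian _
  obtain ⟨n, hn⟩ := Ideal.exists_pow_le_of_le_radical_of_fg (radical_pointIdealB τ₀).ge hfg
  have hprime : Prime (idealAt (N := N) τ₀) :=
    Ideal.prime_of_isPrime (idealAt_ne_bot τ₀) inferInstance
  obtain ⟨e, -, he⟩ := (dvd_prime_pow hprime n).mp (Ideal.dvd_iff_le.mpr hn)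
  rw [associated_iff_eq] at he
  refine ⟨e, Nat.pos_of_ne_zero ?_, he⟩
  rintro rfl
  rw [pow_zero, Ideal.one_eq_top] at he
  exact (idealAt_isPrime (N := N) τ₀).ne_top (top_le_iff.mp (he ▸ pointIdealB_le_idealAt τ₀))

/-! ### `A₀` contains a uniformizer at every point -/

omit [NeZero N] in
/-- Weight casts preserve nonvanishing. [folklore] -/
theorem mcast_ne_zero' {a b : ℤ} (h : a = b) {F : ModularForm (Gamma0 N) a} (hF : F ≠ 0) :
    F.mcast h ≠ 0 := by
  intro h0; apply hF; apply DFunLike.ext; intro τ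
  exact DFunLike.congr_fun h0 τ

/-- Products of nonzero forms are nonzero. [folklore] -/
theorem mul_ne_zero' {a b : ℤ} {F : ModularForm (Gamma0 N) a} {G : ModularForm (Gamma0 N) b}
    (hF : F ≠ 0) (hG : G ≠ 0) : F.mul G ≠ 0 := by
  rw [Ne, ← qExpansionL_eq_zero_iff, qExpansionL_mul, mul_eq_zero, qExpansionL_eq_zero_iff,
    qExpansionL_eq_zero_iff, not_or]
  exact ⟨hF, hG⟩

/-- **At a non-elliptic point of `Γ₀(N)` above `j = 0`, `v₆ = E₄E₄(Nτ)²/Δ` is a uniformizer**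
(`E₄` has a simple zero, `E₄(Nτ) ≠ 0` by `E₄_tpD_smul_ne_zero`). [folklore] -/
theorem pointValuation_coordFn_six {τ : ℍ} (h4 : E₄ τ = 0) (he : ellipticPeriod (Gamma0 N) τ = 1) :
    pointValuation (N := N) τ (coordFn N 6) = WithZero.exp (-1) := by
  obtain ⟨k, hkτ⟩ := E₄_eq_zero_iff.mp h4
  have hk : k * (ModularGroup.S * ModularGroup.T) * k⁻¹ ∉ Gamma0 N := by
    intro hmem
    rw [← hkτ, ellipticPeriod_smul_ρ, adjoinNegI_gamma0, if_pos hmem] at he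
    norm_num at he
  have hN4 : E₄ (tpD N • τ) ≠ 0 := by rw [← hkτ]; exact E₄_tpD_smul_ne_zero N hk
  have hE4 : ofLevelOne (Gamma0 N) E₄ ≠ 0 := ofLevelOne_ne_zero E₄_ne_zero'
  have hV : scaleN N E₄ ≠ 0 := scaleN_ne_zero N E₄_ne_zero'
  have hVV : (scaleN N E₄).mul (scaleN N E₄) ≠ 0 := mul_ne_zero' hV hV
  have hF : coordForm N 6 ≠ 0 := mcast_ne_zero' (by norm_num) (mul_ne_zero' hE4 hVV)
  have hx : coordFn N 6 ≠ 0 := mkFn_ne_zero _ hF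
  rw [pointValuation_apply τ hx]
  congr 1
  have h1 : ordAt τ (coordFn N 6) = 1 := by
    rw [coordFn, ordAt_mkFn_deltaN hF]
    change ((orderAt (((ofLevelOne (Gamma0 N) E₄).mul ((scaleN N E₄).mul (scaleN N E₄))).mcast
      (by norm_num)) τ : ℕ) : ℤ) = 1
    rw [orderAt_mcast, orderAt_mul hE4 hVV, orderAt_mul hV hV, orderAt_scaleN_E₄ hN4,
      orderAt_ofLevelOne_E₄ h4]
    simp
  have h2 := ordAtN_mul_ellipticPeriod τ (coordFn N 6)
  rw [he, h1] at h2
  simp only [Nat.cast_one, mul_one] at h2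
  rw [h2]

/-- **At a non-elliptic point of `Γ₀(N)` above `j = 1728`, `v₃ = E₆E₆(Nτ)/Δ` is a uniformizer**
(`E₆` has a simple zero, `E₆(Nτ) ≠ 0` by `E₆_tpD_smul_ne_zero`). [folklore] -/
theorem pointValuation_coordFn_three {τ : ℍ} (h6 : E₆ τ = 0) (he : ellipticPeriod (Gamma0 N) τ = 1) :
    pointValuation (N := N) τ (coordFn N 3) = WithZero.exp (-1) := by
  obtain ⟨k, hkτ⟩ := E₆_eq_zero_iff.mp h6
  have hk : k * ModularGroup.S * k⁻¹ ∉ Gamma0 N := by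
    intro hmem
    rw [← hkτ, ellipticPeriod_smul_I, adjoinNegI_gamma0, if_pos hmem] at he
    norm_num at he
  have hN6 : E₆ (tpD N • τ) ≠ 0 := by rw [← hkτ]; exact E₆_tpD_smul_ne_zero N hk
  have hE6 : ofLevelOne (Gamma0 N) E₆ ≠ 0 := ofLevelOne_ne_zero E₆_ne_zero'
  have hV : scaleN N E₆ ≠ 0 := scaleN_ne_zero N E₆_ne_zero'
  have hF : coordForm N 3 ≠ 0 := mcast_ne_zero' (by norm_num) (mul_ne_zero' hE6 hV)
  have hx : coordFn N 3 ≠ 0 := mkFn_ne_zero _ hF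
  rw [pointValuation_apply τ hx]
  congr 1
  have h1 : ordAt τ (coordFn N 3) = 1 := by
    rw [coordFn, ordAt_mkFn_deltaN hF]
    change ((orderAt (((ofLevelOne (Gamma0 N) E₆).mul (scaleN N E₆)).mcast (by norm_num)) τ : ℕ) : ℤ) = 1
    rw [orderAt_mcast, orderAt_mul hE6 hV, orderAt_scaleN_E₆ hN6, orderAt_ofLevelOne_E₆ h6]
    simp
  have h2 := ordAtN_mul_ellipticPeriod τ (coordFn N 3)
  rw [he, h1] at h2
  simp only [Nat.cast_one, mul_one] at h2
  rw [h2]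

/-- **`A₀` contains a uniformizer of `P_τ` for every `τ ∈ ℍ`**: `j − j(τ)` when its order `3, 2, 1`
is the period `e_τ`, else `v₆` (above `j = 0`) or `v₃` (above `j = 1728`). [folklore] -/
theorem exists_aeval_pointValuation_eq (τ : ℍ) :
    ∃ p ∈ evalKer N τ, pointValuation (N := N) τ (MvPolynomial.aeval (coordFn N) p) = WithZero.exp (-1) := by
  suffices h : ∃ p : CoordPoly,
      pointValuation (N := N) τ (MvPolynomial.aeval (coordFn N) p) = WithZero.exp (-1) by
    obtain ⟨p, hp⟩ := h
    refine ⟨p, (mem_evalKer_iff_lt_one τ p).mpr ?_, hp⟩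
    rw [hp, ← WithZero.exp_zero, WithZero.exp_lt_exp]; norm_num
  by_cases h : (if E₄ τ = 0 then 3 else if E₆ τ = 0 then 2 else 1) = ellipticPeriod (Gamma0 N) τ
  · refine ⟨MvPolynomial.X 7 - MvPolynomial.C (kleinJ τ), ?_⟩
    rw [aeval_X_sub_C, coordFn_seven, ← kleinJSub_eq]
    exact pointValuation_kleinJSub_of_eq τ h
  have htri := ellipticPeriod_trichotomy (Γ := Gamma0 N) τ
  by_cases h4 : E₄ τ = 0
  · rw [if_pos h4] at h
    have he : ellipticPeriod (Gamma0 N) τ = 1 := by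
      obtain ⟨k, rfl⟩ := E₄_eq_zero_iff.mp h4
      rw [ellipticPeriod_smul_ρ] at h ⊢
      split_ifs at h ⊢ with hm
      · exact absurd rfl h
      · rfl
    exact ⟨MvPolynomial.X 6, by rw [MvPolynomial.aeval_X]; exact pointValuation_coordFn_six h4 he⟩
  rw [if_neg h4] at h
  by_cases h6 : E₆ τ = 0
  · rw [if_pos h6] at h
    have he : ellipticPeriod (Gamma0 N) τ = 1 := by
      obtain ⟨k, rfl⟩ := E₆_eq_zero_iff.mp h6
      rw [ellipticPeriod_smul_I] at h ⊢
      split_ifs at h ⊢ with hm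
      · exact absurd rfl h
      · rfl
    exact ⟨MvPolynomial.X 3, by rw [MvPolynomial.aeval_X]; exact pointValuation_coordFn_three h6 he⟩
  · rw [if_neg h6] at h
    exfalso
    rcases htri with ⟨k, rfl⟩ | ⟨k, rfl⟩ | h1
    · exact h6 (E₆_eq_zero_iff.mpr ⟨k, rfl⟩)
    · exact h4 (E₄_eq_zero_iff.mpr ⟨k, rfl⟩)
    · exact h h1.symm

/-- Elements of `𝔮` have `v_{τ₀} ≤ exp(−1)`. [folklore] -/
theorem pointValuation_le_of_mem_idealAt {τ₀ : ℍ} {b : intClosureJ N} (hb : b ∈ idealAt (N := N) τ₀) :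
    pointValuation (N := N) τ₀ b ≤ WithZero.exp (-1) := by
  rw [mem_idealAt_iff, pointValuation_lt_one_iff] at hb
  rcases hb with h0 | hpos
  · rw [h0, Valuation.map_zero]; exact zero_le
  · have hb0 : (b : modularFunctionField N) ≠ 0 := by
      intro h0; rw [h0, ordAtN_zero] at hpos; exact lt_irrefl _ hpos
    rw [pointValuation_apply τ₀ hb0, WithZero.exp_le_exp]; omega

/-- Elements of `𝔮²` have `v_{τ₀} ≤ exp(−2)`. [folklore] -/
theorem pointValuation_le_of_mem_sq {τ₀ : ℍ} {b : intClosureJ N}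
    (hb : b ∈ idealAt (N := N) τ₀ ^ 2) : pointValuation (N := N) τ₀ b ≤ WithZero.exp (-2) := by
  rw [pow_two] at hb
  refine Submodule.mul_induction_on
    (C := fun b : intClosureJ N ↦ pointValuation (N := N) τ₀ b ≤ WithZero.exp (-2)) hb
    (fun m hm n hn ↦ ?_) (fun x y hx hy ↦ ?_)
  · rw [Subalgebra.coe_mul, Valuation.map_mul, show (-2 : ℤ) = -1 + -1 by norm_num, WithZero.exp_add]
    exact mul_le_mul' (pointValuation_le_of_mem_idealAt hm) (pointValuation_le_of_mem_idealAt hn)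
  · rw [Subalgebra.coe_add]
    exact (Valuation.map_add _ _ _).trans (max_le hx hy)

/-- **`𝔭B = 𝔮`**: the point ideal generates the maximal ideal of `B` at `τ₀` (`𝔭B = 𝔮ᵉ` and `A₀`
contains a uniformizer, so `e = 1`). [folklore] -/
theorem pointIdealB_eq_idealAt (τ₀ : ℍ) : pointIdealB N τ₀ = idealAt (N := N) τ₀ := by
  obtain ⟨e, he0, he⟩ := exists_pointIdealB_eq_pow (N := N) τ₀
  obtain ⟨p, hp, hpv⟩ := exists_aeval_pointValuation_eq (N := N) τ₀
  have hmem : aevalB N p ∈ pointIdealB N τ₀ := Ideal.mem_map_of_mem _ hp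
  rcases Nat.lt_or_ge e 2 with hlt | hge
  · obtain rfl : e = 1 := by omega
    rw [he, pow_one]
  · exfalso
    rw [he] at hmem
    have h2 := pointValuation_le_of_mem_sq (Ideal.pow_le_pow_right hge hmem)
    rw [coe_aevalB, hpv, WithZero.exp_le_exp] at h2
    norm_num at h2

/-! ### Nakayama: `sB ⊆ A₀` for some `s ∈ A₀` with `s(τ₀) = 1` -/

/-- Elements of `𝔭B` lie in the `P`-submodule `𝔭_{τ₀} • B` of `K_N`. [folklore] -/
theorem coe_mem_smul_of_mem_pointIdealB {τ₀ : ℍ} {b : intClosureJ N} (hb : b ∈ pointIdealB N τ₀) :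
    (b : modularFunctionField N) ∈ evalKer N τ₀ • intClosureMod N := by
  replace hb : b ∈ Ideal.span ((aevalB N) '' (evalKer N τ₀)) := hb
  induction hb using Submodule.span_induction with
  | mem x hx =>
    obtain ⟨p, hp, rfl⟩ := hx
    rw [coe_aevalB, ← mul_one (MvPolynomial.aeval _ p), ← coord_smul_def]
    exact Submodule.smul_mem_smul hp (show (1 : modularFunctionField N) ∈ intClosureMod N from
      one_mem (intClosureJ N))
  | zero => exact zero_mem _
  | add x y _ _ hx hy => rw [Subalgebra.coe_add]; exact add_mem hx hy
  | smul c x _ hx =>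
    rw [smul_eq_mul, Subalgebra.coe_mul]
    refine Submodule.smul_induction_on (p := fun y ↦ (c : modularFunctionField N) * y ∈
      evalKer N τ₀ • intClosureMod N) hx (fun r hr n hn ↦ ?_) (fun y z hy hz ↦ ?_)
    · rw [coord_smul_def, mul_left_comm, ← coord_smul_def]
      have hn' : n ∈ intClosureJ N := hn
      have hcn : (c : modularFunctionField N) * n ∈ intClosureJ N := mul_mem c.2 hn'
      exact Submodule.smul_mem_smul hr hcn
    · rw [mul_add]; exact add_mem hy hz

/-- Constants lie in `B`. [folklore] -/
theorem algebraMap_mem_intClosureJ (c : ℂ) : algebraMap ℂ (modularFunctionField N) c ∈ intClosureJ N := by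
  rw [IsScalarTower.algebraMap_apply ℂ ℂ[X] (modularFunctionField N)]
  exact (intClosureJ N).algebraMap_mem _

/-- **`B = A₀ + 𝔭B`**, module form: `B ≤ P·1 + 𝔭_{τ₀} • B` (every `b ∈ B` is its value at `τ₀` plus an
element of `𝔮 = 𝔭B`). [folklore] -/
theorem intClosureMod_le_sup (τ₀ : ℍ) :
    intClosureMod N ≤ Submodule.span CoordPoly {(1 : modularFunctionField N)} ⊔
      evalKer N τ₀ • intClosureMod N := by
  intro b hb
  have hbB : b ∈ intClosureJ N := hb
  have hbO : b ∈ (pointPlace (N := N) τ₀).toValuationSubring := mem_pointPlace_of_mem_intClosureJ hbB τ₀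
  obtain ⟨c, hc⟩ :=
    (PlaceOver.isRational_of_isAlgClosed (pointPlace (N := N) τ₀)).exists_sub_algebraMap_mem hbO
  have hlt : pointValuation (N := N) τ₀ (b - algebraMap ℂ (modularFunctionField N) c) < 1 := by
    rw [← mem_nonunits_pointPlace_iff, ValuationSubring.mem_nonunits_iff]
    rw [PlaceOver.mem_ball_iff, zpow_one] at hc
    exact hc.trans_lt (pointPlace (N := N) τ₀).valuation_uniformizer_lt_one
  have hq : (⟨b - algebraMap ℂ (modularFunctionField N) c, sub_mem hbB (algebraMap_mem_intClosureJ c)⟩ :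
      intClosureJ N) ∈ idealAt (N := N) τ₀ := (mem_idealAt_iff τ₀ _).mpr hlt
  rw [← pointIdealB_eq_idealAt] at hq
  have h1 := coe_mem_smul_of_mem_pointIdealB hq
  have h2 : algebraMap ℂ (modularFunctionField N) c ∈
      Submodule.span CoordPoly {(1 : modularFunctionField N)} := by
    rw [IsScalarTower.algebraMap_apply ℂ CoordPoly (modularFunctionField N), Algebra.algebraMap_eq_smul_one]
    exact Submodule.smul_mem _ _ (Submodule.subset_span rfl)
  have heq : b = algebraMap ℂ (modularFunctionField N) c + (b - algebraMap ℂ (modularFunctionField N) c) := by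
    ring
  rw [heq]
  exact Submodule.add_mem_sup h2 h1

/-- **Nakayama**: there is `r ∈ P` with `r ≡ 1 (mod 𝔭_{τ₀})` — so `r(v)(τ₀) = 1` — and
`r(v)·B ⊆ A₀` (Atiyah–Macdonald Cor. 2.5 applied to `B/A₀` over `P`). [folklore] -/
theorem exists_aeval_mul_intClosureJ_subset (τ₀ : ℍ) :
    ∃ r : CoordPoly, r - 1 ∈ evalKer N τ₀ ∧ ∀ b ∈ intClosureJ N, ∃ q : CoordPoly,
      MvPolynomial.aeval (coordFn N) r * b = MvPolynomial.aeval (coordFn N) q := by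
  set A₀ : Submodule CoordPoly (modularFunctionField N) := Submodule.span CoordPoly {1} with hA₀
  set M := intClosureMod N with hM
  set M' := M.map A₀.mkQ with hM'
  have hfg : M'.FG := (intClosureMod_fg (N := N)).map _
  have hle : M' ≤ evalKer N τ₀ • M' := by
    calc M' = M.map A₀.mkQ := rfl
      _ ≤ (A₀ ⊔ evalKer N τ₀ • M).map A₀.mkQ := Submodule.map_mono (intClosureMod_le_sup τ₀)
      _ = evalKer N τ₀ • M' := by
        rw [Submodule.map_sup, Submodule.mkQ_map_self, bot_sup_eq, Submodule.map_smul'']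
  obtain ⟨r, hr, hrN⟩ := Submodule.exists_sub_one_mem_and_smul_eq_zero_of_fg_of_le_smul _ _ hfg hle
  refine ⟨r, hr, fun b hb ↦ ?_⟩
  have h0 : r • A₀.mkQ b = 0 := hrN _ (Submodule.mem_map_of_mem (show b ∈ M from hb))
  rw [← map_smul, Submodule.mkQ_apply, Submodule.Quotient.mk_eq_zero, hA₀,
    Submodule.mem_span_singleton] at h0
  obtain ⟨q, hq⟩ := h0
  refine ⟨q, ?_⟩
  rw [← coord_smul_def, ← hq, coord_smul_def, mul_one]


/-! ### Killing the poles away from `τ₀` and the local representation theorem -/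

/-- A place over `j(τ₀)` other than `P_{τ₀}` is `P_{τ'}` for a `τ'` at which some Eisenstein
coordinate differs from its value at `τ₀` (the coordinates separate `Y₀(N)`). [folklore] -/
theorem exists_eisCoord_ne_of_mem_placesOver {τ₀ : ℍ} {P : PlaceOver ℂ (modularFunctionField N)}
    (hP : P ∈ placesOver N τ₀) (hP0 : P ≠ pointPlace (N := N) τ₀) :
    ∃ τi : ℍ × Fin 6, pointPlace (N := N) τi.1 = P ∧ eisCoord N τi.2 τi.1 ≠ eisCoord N τi.2 τ₀ := by
  obtain ⟨g, rfl⟩ := mem_placesOver_iff.mp hP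
  by_contra hne
  push Not at hne
  have heq : ∀ i : Fin 6, eisCoord N i (g⁻¹ • τ₀) = eisCoord N i τ₀ := fun i ↦ hne ⟨g⁻¹ • τ₀, i⟩ rfl
  obtain ⟨γ, hγ⟩ := exists_gamma0_smul_eq_of_eisCoord_eq heq
  apply hP0
  rw [← pointPlace_smul_of_mem γ.2 (g⁻¹ • τ₀), hγ]

variable (N) in
/-- The "pole killer" attached to a place `P` (relative to `τ₀`): `Xᵢ − vᵢ(τ')` for a choice of
`τ'` with `P = P_{τ'}` and of a coordinate `vᵢ` with `vᵢ(τ') ≠ vᵢ(τ₀)` (and `1` if there is none).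
[folklore] -/
def killer (τ₀ : ℍ) (P : PlaceOver ℂ (modularFunctionField N)) : CoordPoly :=
  if h : ∃ τi : ℍ × Fin 6, pointPlace (N := N) τi.1 = P ∧ eisCoord N τi.2 τi.1 ≠ eisCoord N τi.2 τ₀ then
    MvPolynomial.X (Fin.castLE (by norm_num) h.choose.2) - MvPolynomial.C (eisCoord N h.choose.2 h.choose.1)
  else 1

/-- The pole killer does not vanish at `τ₀`. [folklore] -/
theorem killer_not_mem_evalKer (τ₀ : ℍ) (P : PlaceOver ℂ (modularFunctionField N)) :
    killer N τ₀ P ∉ evalKer N τ₀ := by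
  rw [mem_evalKer_iff, killer]
  split_ifs with h
  · rw [map_sub, MvPolynomial.eval_X, MvPolynomial.eval_C, coordVal_castLE, sub_eq_zero]
    exact h.choose_spec.2.symm
  · rw [map_one]; exact one_ne_zero

/-- The pole killer of a place `P ≠ P_{τ₀}` over `j(τ₀)` vanishes at `P`. [folklore] -/
theorem aeval_killer_mem_nonunits {τ₀ : ℍ} {P : PlaceOver ℂ (modularFunctionField N)}
    (hP : P ∈ placesOver N τ₀) (hP0 : P ≠ pointPlace (N := N) τ₀) :
    MvPolynomial.aeval (coordFn N) (killer N τ₀ P) ∈ P.toValuationSubring.nonunits := by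
  have h := exists_eisCoord_ne_of_mem_placesOver hP hP0
  rw [killer, dif_pos h]
  obtain ⟨hP', -⟩ := h.choose_spec
  set τ' := h.choose.1
  set i := h.choose.2
  clear_value τ' i
  subst hP'
  rw [mem_nonunits_pointPlace_iff, aeval_X_sub_C, ← coordVal_castLE]
  exact pointValuation_coordFn_sub_lt_one _ _

/-- `ord_{P_τ}(j − j(τ₀)) ≤ μ` at a place over `j(τ₀)` (`∑ ord = μ`, `sum_ord_placesOver`). [folklore] -/
theorem ordAtN_kleinJSub_le {τ₀ τ : ℍ} (hP : pointPlace (N := N) τ ∈ placesOver N τ₀) :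
    ordAtN τ (kleinJSub N τ₀) ≤ gamma0Index N := by
  rw [← ord_pointPlace τ (kleinJSub_ne_zero τ₀), ← sum_ord_placesOver (N := N) τ₀]
  exact Finset.single_le_sum (fun P hP' ↦ (ord_pos_of_mem_placesOver hP').le) hP

/-- `ord_{P_τ}(j − j(τ₀)) = 0` at a place not over `j(τ₀)`. [folklore] -/
theorem ordAtN_kleinJSub_eq_zero {τ₀ τ : ℍ} (hP : pointPlace (N := N) τ ∉ placesOver N τ₀) :
    ordAtN τ (kleinJSub N τ₀) = 0 := by
  have h1 : ¬ 0 < ordAtN τ (kleinJSub N τ₀) := fun h ↦ hP (by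
    rw [← ord_pointPlace τ (kleinJSub_ne_zero τ₀)] at h
    exact mem_placesOver_iff.mpr (ord_kleinJSub_pos_iff.mp h))
  have h2 : 0 ≤ ordAtN τ (kleinJSub N τ₀) := by
    have := (mem_pointPlace_iff τ _).mp (mkFn_deltaN_mem_pointPlace (N := N)
      (E₄cubeSubSmulDelta N (kleinJ τ₀)) τ)
    rw [pointValuation_le_one_iff] at this
    rcases this with h0 | h0
    · exact absurd h0 (kleinJSub_ne_zero τ₀)
    · exact h0
  omega

/-- **Local representation of `O_{P_{τ₀}}` by Eisenstein coordinates.**  For every `τ₀ ∈ ℍ` and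
every modular function `h ∈ K_N` regular at `τ₀` there are coordinate polynomials `p, q` with
`q(v(τ₀)) ≠ 0` (`q ∉ 𝔭_{τ₀}`) and `h · q(v) = p(v)`: the local ring of `X₀(N)` at `τ₀` is the local ring
of `A₀ = ℂ[v]` at the point `v(τ₀)` (Shimura §1.6–1.8, §2.4; Diamond–Shurman §7.5).
[cite: DiamondShurman2005, §7.5] -/
theorem exists_mul_aeval_eq_aeval (τ₀ : ℍ) {h : modularFunctionField N}
    (hh : h ∈ (pointPlace (N := N) τ₀).toValuationSubring) :
    ∃ p q : CoordPoly, q ∉ evalKer N τ₀ ∧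
      h * MvPolynomial.aeval (coordFn N) q = MvPolynomial.aeval (coordFn N) p := by
  classical
  obtain ⟨r, hr1, hr⟩ := exists_aeval_mul_intClosureJ_subset (N := N) τ₀
  have hr0 : r ∉ evalKer N τ₀ := fun h0 ↦ by
    have h1 : r - (r - 1) ∈ evalKer N τ₀ := sub_mem h0 hr1
    rw [sub_sub_cancel, mem_evalKer_iff, map_one] at h1
    exact one_ne_zero h1
  -- Step 1: `a(j) h ∈ B`, `a = (X − j₀)ⁿ a₁`, `a₁(j₀) ≠ 0`
  obtain ⟨a, ha0, haB⟩ := exists_polyJ_smul_mem_intClosureJ h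
  set j₀ := kleinJ τ₀ with hj₀
  obtain ⟨a₁, ha, hndvd⟩ := a.exists_eq_pow_rootMultiplicity_mul_and_not_dvd ha0 j₀
  set n := a.rootMultiplicity j₀ with hn
  have ha₁0 : a₁.eval j₀ ≠ 0 := fun h0 ↦ hndvd (Polynomial.dvd_iff_isRoot.mpr h0)
  have haj : Polynomial.aeval (kleinJK N) a =
      kleinJSub N τ₀ ^ n * Polynomial.aeval (kleinJK N) a₁ := by
    rw [ha, map_mul, map_pow, map_sub, aeval_X, aeval_C, kleinJSub_eq]
  have ha₁ : polyToCoord a₁ ∉ evalKer N τ₀ := by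
    rw [mem_evalKer_iff_lt_one, aeval_polyToCoord, not_lt]
    obtain ⟨w, hw⟩ := Polynomial.X_sub_C_dvd_sub_C_eval (p := a₁) (a := j₀)
    have heq : Polynomial.aeval (kleinJK N) a₁ =
        algebraMap ℂ (modularFunctionField N) (a₁.eval j₀) +
          kleinJSub N τ₀ * Polynomial.aeval (kleinJK N) w := by
      have h1 := congrArg (Polynomial.aeval (kleinJK N)) hw
      rw [map_sub, map_mul, map_sub, aeval_X, aeval_C, aeval_C, ← kleinJSub_eq] at h1
      rw [← h1]; ring
    have hlt : pointValuation (N := N) τ₀ (kleinJSub N τ₀ * Polynomial.aeval (kleinJK N) w) <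
        pointValuation (N := N) τ₀ (algebraMap ℂ (modularFunctionField N) (a₁.eval j₀)) := by
      rw [pointValuation_algebraMap_eq_one ha₁0, Valuation.map_mul]
      calc _ ≤ pointValuation (N := N) τ₀ (kleinJSub N τ₀) * 1 :=
            mul_le_mul' le_rfl ((mem_pointPlace_iff τ₀ _).mp (aeval_kleinJK_mem_pointPlace τ₀ w))
        _ < 1 := by
          rw [mul_one, pointValuation_lt_one_iff]
          exact Or.inr (ordAtN_kleinJSub_pos τ₀)
    rw [heq, Valuation.map_add_eq_of_lt_left _ hlt, pointValuation_algebraMap_eq_one ha₁0]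
  -- Step 2: `h₁ = a₁(j) h ∈ O_{τ₀}` and `(j − j₀)ⁿ h₁ ∈ B`
  set h₁ := Polynomial.aeval (kleinJK N) a₁ * h with hh₁
  have hh₁O : h₁ ∈ (pointPlace (N := N) τ₀).toValuationSubring :=
    mul_mem (aeval_kleinJK_mem_pointPlace τ₀ a₁) hh
  have hz : kleinJSub N τ₀ ^ n * h₁ ∈ intClosureJ N := by
    have : kleinJSub N τ₀ ^ n * h₁ = a • h := by rw [Algebra.smul_def, algebraMap_polyJ, haj]; ring
    rw [this]; exact haB
  -- Step 3: the pole killer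
  set P₀ := pointPlace (N := N) τ₀ with hP₀
  set S := (placesOver N τ₀).erase P₀ with hS
  set kp : CoordPoly := (∏ P ∈ S, killer N τ₀ P) ^ (n * gamma0Index N) with hkp_def
  have hkp : kp ∉ evalKer N τ₀ := by
    rw [mem_evalKer_iff_lt_one, hkp_def, map_pow, map_prod, Valuation.map_pow, map_prod,
      Finset.prod_eq_one fun P _ ↦ pointValuation_aeval_eq_one_of_not_mem (killer_not_mem_evalKer τ₀ P),
      one_pow]
    exact lt_irrefl 1
  -- Step 4: `kp(v) h₁ ∈ B`
  have hy : MvPolynomial.aeval (coordFn N) kp * h₁ ∈ intClosureJ N := by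
    apply mem_intClosureJ_of_forall_mem
    intro τ
    rw [mem_pointPlace_iff, Valuation.map_mul]
    by_cases hP : pointPlace (N := N) τ ∈ placesOver N τ₀
    · by_cases hPe : pointPlace (N := N) τ = P₀
      · have h1 : h₁ ∈ (pointPlace (N := N) τ).toValuationSubring := by rw [hPe]; exact hh₁O
        calc _ ≤ (1 : ℤᵐ⁰) * 1 :=
              mul_le_mul' (pointValuation_aeval_le_one kp τ) ((mem_pointPlace_iff τ _).mp h1)
          _ = 1 := one_mul 1
      · have hPS : pointPlace (N := N) τ ∈ S := Finset.mem_erase.mpr ⟨hPe, hP⟩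
        have hk : pointValuation (N := N) τ (MvPolynomial.aeval (coordFn N) (killer N τ₀ (pointPlace τ))) ≤
            WithZero.exp (-1) :=
          pointValuation_le_exp_neg_one_of_lt_one ((mem_nonunits_pointPlace_iff τ _).mp
            (aeval_killer_mem_nonunits hP hPe))
        have hprod : pointValuation (N := N) τ (MvPolynomial.aeval (coordFn N) (∏ P ∈ S, killer N τ₀ P)) ≤
            WithZero.exp (-1) := by
          rw [map_prod, map_prod, ← Finset.prod_erase_mul _ _ hPS]
          calc _ ≤ 1 * WithZero.exp (-1) :=
                mul_le_mul' (Finset.prod_le_one' fun P _ ↦ pointValuation_aeval_le_one _ τ) hk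
            _ = WithZero.exp (-1) := one_mul _
        have hkpτ : pointValuation (N := N) τ (MvPolynomial.aeval (coordFn N) kp) ≤
            WithZero.exp (-((n * gamma0Index N : ℕ) : ℤ)) := by
          rw [hkp_def, map_pow, Valuation.map_pow]
          calc _ ≤ WithZero.exp (-1) ^ (n * gamma0Index N) := pow_le_pow_left' hprod _
            _ = _ := by rw [exp_pow_eq]; simp
        set e := ordAtN τ (kleinJSub N τ₀) with he
        have he_le : e ≤ gamma0Index N := ordAtN_kleinJSub_le hP
        have hzv := pointValuation_le_one_of_mem_intClosureJ hz τ
        rw [Valuation.map_mul, Valuation.map_pow, pointValuation_apply τ (kleinJSub_ne_zero τ₀), ← he,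
          exp_pow_eq] at hzv
        -- `hzv : exp(-n e) · v(h₁) ≤ 1`, so `v(h₁) ≤ exp(n e)`
        have hh₁v : pointValuation (N := N) τ h₁ ≤ WithZero.exp ((n : ℤ) * e) := by
          have h1 : pointValuation (N := N) τ h₁ =
              WithZero.exp ((n : ℤ) * e) * (WithZero.exp ((n : ℤ) * -e) * pointValuation (N := N) τ h₁) := by
            rw [← mul_assoc, ← WithZero.exp_add, show (n : ℤ) * e + n * -e = 0 by ring,
              WithZero.exp_zero, one_mul]
          rw [h1]
          calc _ ≤ WithZero.exp ((n : ℤ) * e) * 1 := mul_le_mul' le_rfl hzv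
            _ = _ := mul_one _
        calc _ ≤ WithZero.exp (-((n * gamma0Index N : ℕ) : ℤ)) * WithZero.exp ((n : ℤ) * e) :=
              mul_le_mul' hkpτ hh₁v
          _ ≤ 1 := by
            rw [← WithZero.exp_add, ← WithZero.exp_zero, WithZero.exp_le_exp]
            push_cast
            nlinarith [he_le, (Nat.cast_nonneg n : (0 : ℤ) ≤ n)]
    · -- `τ` not over `j(τ₀)`: `j − j₀` is a unit there
      have he0 := ordAtN_kleinJSub_eq_zero hP
      have hzv := pointValuation_le_one_of_mem_intClosureJ hz τ
      rw [Valuation.map_mul, Valuation.map_pow, pointValuation_apply τ (kleinJSub_ne_zero τ₀), he0,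
        neg_zero, WithZero.exp_zero, one_pow, one_mul] at hzv
      calc _ ≤ (1 : ℤᵐ⁰) * 1 := mul_le_mul' (pointValuation_aeval_le_one kp τ) hzv
        _ = 1 := one_mul 1
  -- Step 5: conclude with Nakayama's multiplier `r`
  obtain ⟨q₀, hq₀⟩ := hr _ hy
  refine ⟨q₀, polyToCoord a₁ * kp * r, fun hmem ↦ ?_, ?_⟩
  · rw [mem_evalKer_iff_lt_one] at hmem
    simp only [map_mul, pointValuation_aeval_eq_one_of_not_mem ha₁,
      pointValuation_aeval_eq_one_of_not_mem hkp, pointValuation_aeval_eq_one_of_not_mem hr0, mul_one,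
      lt_self_iff_false] at hmem
  · rw [← hq₀, map_mul, map_mul, aeval_polyToCoord, hh₁]; ring

/-- **Corollary (value form).**  With `p, q` as in `exists_mul_aeval_eq_aeval`, `q(v(τ₀)) ≠ 0` and the
value of `h` at `τ₀` is `p(v(τ₀))/q(v(τ₀))`: `v_{τ₀}(h − p(v(τ₀))/q(v(τ₀))) < 1`. [folklore] -/
theorem exists_pointValuation_sub_div_lt_one (τ₀ : ℍ) {h : modularFunctionField N}
    (hh : h ∈ (pointPlace (N := N) τ₀).toValuationSubring) :
    ∃ p q : CoordPoly, MvPolynomial.eval (fun i ↦ coordVal N i τ₀) q ≠ 0 ∧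
      h * MvPolynomial.aeval (coordFn N) q = MvPolynomial.aeval (coordFn N) p ∧
      pointValuation (N := N) τ₀ (h - algebraMap ℂ (modularFunctionField N)
        (MvPolynomial.eval (fun i ↦ coordVal N i τ₀) p / MvPolynomial.eval (fun i ↦ coordVal N i τ₀) q)) < 1 := by
  obtain ⟨p, q, hq, hpq⟩ := exists_mul_aeval_eq_aeval τ₀ hh
  have hq' : MvPolynomial.eval (fun i ↦ coordVal N i τ₀) q ≠ 0 := fun h0 ↦ hq ((mem_evalKer_iff τ₀ q).mpr h0)
  refine ⟨p, q, hq', hpq, ?_⟩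
  set cp := MvPolynomial.eval (fun i ↦ coordVal N i τ₀) p
  set cq := MvPolynomial.eval (fun i ↦ coordVal N i τ₀) q
  set Q := MvPolynomial.aeval (coordFn N) q
  set Pv := MvPolynomial.aeval (coordFn N) p
  have hQ1 : pointValuation (N := N) τ₀ Q = 1 := pointValuation_aeval_eq_one_of_not_mem hq
  -- `(h − cp/cq)·Q = (Pv − cp) − (cp/cq)(Q − cq)`
  have hid : (h - algebraMap ℂ (modularFunctionField N) (cp / cq)) * Q =
      (Pv - algebraMap ℂ _ cp) - algebraMap ℂ _ (cp / cq) * (Q - algebraMap ℂ _ cq) := by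
    rw [sub_mul, hpq, map_div₀]
    field_simp [(_root_.map_ne_zero (algebraMap ℂ (modularFunctionField N))).mpr hq']
    ring
  have hlt : pointValuation (N := N) τ₀ ((h - algebraMap ℂ (modularFunctionField N) (cp / cq)) * Q) < 1 := by
    rw [hid]
    refine (Valuation.map_sub _ _ _).trans_lt (max_lt (pointValuation_aeval_sub_eval_lt_one p τ₀) ?_)
    rw [Valuation.map_mul]
    calc _ ≤ 1 * pointValuation (N := N) τ₀ (Q - algebraMap ℂ _ cq) :=
          mul_le_mul' (pointValuation_algebraMap_le_one _ τ₀) le_rfl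
      _ < 1 := by rw [one_mul]; exact pointValuation_aeval_sub_eval_lt_one q τ₀
  rwa [Valuation.map_mul, hQ1, mul_one] at hlt

end Literature.NumberTheory.EllipticCurves.ModularForms

end
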